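import Mathlib
import HarnessLib
import Summits.PneNP.PneNP.Theorems.CnfIdealGenLengthRankDefectRepresentationsTseitinTransferRank
import Summits.PneNP.PneNP.Theorems.CnfIdealGenLengthRankDefectRepresentationsNumberOperator
import Summits.PneNP.PneNP.Theorems.CnfIdealGenLengthRankDefectRepresentationsNumberOperatorCompression

/-!
# Weight decomposition of an almost-representation (stub `stub_weightDecomposition`, line rank-dehn-ladder)

Crux `stmt-PneNP-18923` (`Summit.PneNP.PneNP.Theses.CnfIdealGenLength.RankDefectRepresentations`), line
`rank-dehn-ladder`, negative rung N0c.  For idempotent matrices `ε₁,…,εₙ` over a field of characteristic zero with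
pairwise commutator ranks `≤ t`, there is an EXACT complete orthogonal family of idempotents `Q₀,…,Qₙ` with
`rank (∑ k•Q_k − ∑ ε_i) ≤ 10(n+1)⁴t` and `rank [Q_k, ε_i] ≤ 10(n+1)⁴t`: the approximate weight (number-operator)
decomposition.  Proof: with `E = ∑ ε_i` and `N = ∏_{k=0}^{n} (E − k)` (rank `≤ n³t`, the Number Operator Lemma
`…NumberOperator.rank_numberOperator_le`), take a generalized inverse `N B N = N`, the idempotent `π = 1 − B N`
(kernel projection: `N π = 0`, `rank (1 − π) ≤ rank N`, and `π A π = A π` for every `A` commuting with `N`), and the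
Lagrange idempotents `L_k = ℓ_k(E)` at the nodes `0,…,n`; put `Q_k = L_k π + [k = 0](1 − π)`.  Exactness follows from
divisibility of `ℓ_k ℓ_l`, `ℓ_k² − ℓ_k`, `∑ k ℓ_k − X` by the nodal polynomial; the commutator bound is the Cauchy
compression estimate `…NumberOperatorCompression.rank_sub_compression_le`.
HONEST FRAMING: elementary linear algebra; P ≠ NP is not moved; F-N2 is a FRONTIER formal rung.
-/

set_option linter.dupNamespace false -- `Summit.PneNP.PneNP.…`: summit = sub-problem name (D-0017)

namespace Summit.PneNP.PneNP.Theorems.CnfIdealGenLengthRankDefectRepresentationsWeightDecomposition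

open Finset Polynomial
open Literature.Computability.AlgebraicComplexity (rank_sum_le rank_smul_le)
open Summit.PneNP.PneNP.Theorems.CnfIdealGenLengthRankDefectRepresentationsTseitinTransfer (rk_add rk_sub rk_neg)
open Summit.PneNP.PneNP.Theorems.CnfIdealGenLengthRankDefectRepresentationsNumberOperator (rank_numberOperator_le)
open Summit.PneNP.PneNP.Theorems.CnfIdealGenLengthRankDefectRepresentationsNumberOperatorCompression
  (rank_sub_compression_le compression_commutes)

variable {K : Type} [Field K] {d : ℕ}

/-! ## §1 Generalized inverse and the kernel projection `π = 1 - B N` -/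

/-- Every square matrix over a field has a generalized inverse: `N B N = N`. [folklore] -/
theorem exists_generalized_inverse (N : Matrix (Fin d) (Fin d) K) :
    ∃ B : Matrix (Fin d) (Fin d) K, N * B * N = N := by
  obtain ⟨s, hs⟩ := LinearMap.exists_rightInverse_of_surjective (Matrix.toLin' N).rangeRestrict
    (LinearMap.range_rangeRestrict _)
  obtain ⟨q, hq⟩ := LinearMap.exists_leftInverse_of_injective (LinearMap.range (Matrix.toLin' N)).subtype
    (Submodule.ker_subtype _)
  refine ⟨LinearMap.toMatrix' (s ∘ₗ q), ?_⟩
  have key : ∀ x, Matrix.toLin' N ((s ∘ₗ q) (Matrix.toLin' N x)) = Matrix.toLin' N x := by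
    intro x
    have h1 : q (Matrix.toLin' N x) = (Matrix.toLin' N).rangeRestrict x := by
      have := LinearMap.congr_fun hq ((Matrix.toLin' N).rangeRestrict x)
      simpa using this
    have h2 : ∀ y, (Matrix.toLin' N).rangeRestrict (s y) = y := fun y => LinearMap.congr_fun hs y
    rw [LinearMap.comp_apply, h1]
    have h3 : Matrix.toLin' N (s ((Matrix.toLin' N).rangeRestrict x)) =
        ((Matrix.toLin' N).rangeRestrict (s ((Matrix.toLin' N).rangeRestrict x)) : Fin d → K) := rfl
    rw [h3, h2]; rfl
  apply Matrix.toLin'.injective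
  rw [Matrix.toLin'_mul, Matrix.toLin'_mul, Matrix.toLin'_toMatrix']
  exact LinearMap.ext fun x => key x

/-- `N π = 0` for `π = 1 - B N`, `N B N = N`. -/
theorem mul_kerProj (N B : Matrix (Fin d) (Fin d) K) (hB : N * B * N = N) : N * (1 - B * N) = 0 := by
  rw [mul_sub, mul_one, ← Matrix.mul_assoc, hB, sub_self]

/-- `π = 1 - B N` is idempotent when `N B N = N`. -/
theorem kerProj_idem (N B : Matrix (Fin d) (Fin d) K) (hB : N * B * N = N) :
    (1 - B * N) * (1 - B * N) = 1 - B * N := by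
  have h : B * N * (B * N) = B * N := by
    rw [Matrix.mul_assoc, ← Matrix.mul_assoc N B N, hB]
  rw [sub_mul, one_mul, mul_sub, mul_one, h, sub_self, sub_zero]

/-- `π A π = A π` for every `A` commuting with `N` (the range of `π` — the kernel of `N` — is `A`-invariant). -/
theorem kerProj_mul_mul_kerProj (N B A : Matrix (Fin d) (Fin d) K) (hB : N * B * N = N) (hA : A * N = N * A) :
    (1 - B * N) * (A * (1 - B * N)) = A * (1 - B * N) := by
  have h0 : B * N * (A * (1 - B * N)) = 0 := by
    calc B * N * (A * (1 - B * N)) = B * (N * A) * (1 - B * N) := by simp only [Matrix.mul_assoc]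
      _ = B * A * (N * (1 - B * N)) := by rw [← hA]; simp only [Matrix.mul_assoc]
      _ = 0 := by rw [mul_kerProj N B hB, Matrix.mul_zero]
  rw [sub_mul, one_mul, h0, sub_zero]

/-- `(A π)(1 - π) = 0`. -/
theorem mul_kerProj_mul_one_sub (N B A : Matrix (Fin d) (Fin d) K) (hB : N * B * N = N) :
    A * (1 - B * N) * (1 - (1 - B * N)) = 0 := by
  rw [Matrix.mul_assoc, mul_sub, mul_one, kerProj_idem N B hB, sub_self, Matrix.mul_zero]

/-- `(1 - π)(A π) = 0` for `A` commuting with `N`. -/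
theorem one_sub_mul_mul_kerProj (N B A : Matrix (Fin d) (Fin d) K) (hB : N * B * N = N) (hA : A * N = N * A) :
    (1 - (1 - B * N)) * (A * (1 - B * N)) = 0 := by
  rw [sub_mul, one_mul, kerProj_mul_mul_kerProj N B A hB hA, sub_self]

/-- `(1 - π)² = 1 - π`. -/
theorem one_sub_kerProj_idem (N B : Matrix (Fin d) (Fin d) K) (hB : N * B * N = N) :
    (1 - (1 - B * N)) * (1 - (1 - B * N)) = 1 - (1 - B * N) := by
  rw [sub_sub_cancel, ← Matrix.mul_assoc, Matrix.mul_assoc B N B]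
  conv_lhs => rw [Matrix.mul_assoc B (N * B) N, Matrix.mul_assoc N B N, ← Matrix.mul_assoc N B N, hB]

/-- `rank (1 - π) ≤ rank N`. -/
theorem rank_one_sub_kerProj (N B : Matrix (Fin d) (Fin d) K) : (1 - (1 - B * N)).rank ≤ N.rank := by
  rw [sub_sub_cancel]; exact Matrix.rank_mul_le_right _ _

/-- A multiple `A' N` of `N` kills `π`. -/
theorem mul_kerProj_eq_zero (N B A' : Matrix (Fin d) (Fin d) K) (hB : N * B * N = N) :
    A' * N * (1 - B * N) = 0 := by
  rw [Matrix.mul_assoc, mul_kerProj N B hB, Matrix.mul_zero]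

/-! ## §2 Lagrange idempotents at distinct nodes: congruences modulo the nodal polynomial -/

section Lagrange

variable {ι : Type} [Fintype ι] [DecidableEq ι] {v : ι → K}

/-- `ℓ_k ℓ_l` vanishes at every node (`k ≠ l`). -/
theorem eval_basis_mul_basis_of_ne {k l : ι} (hkl : k ≠ l) (j : ι) :
    eval (v j) (Lagrange.basis univ v k * Lagrange.basis univ v l) = 0 := by
  rw [eval_mul]
  by_cases hjk : j = k
  · subst hjk
    rw [Lagrange.eval_basis_of_ne (Ne.symm hkl) (mem_univ _), mul_zero]
  · rw [Lagrange.eval_basis_of_ne (v := v) (fun h => hjk h.symm) (mem_univ _), zero_mul]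

/-- `ℓ_k² - ℓ_k` vanishes at every node. -/
theorem eval_basis_sq_sub_basis (hv : Function.Injective v) (k j : ι) :
    eval (v j) (Lagrange.basis univ v k * Lagrange.basis univ v k - Lagrange.basis univ v k) = 0 := by
  rw [eval_sub, eval_mul]
  by_cases hjk : j = k
  · subst hjk
    rw [Lagrange.eval_basis_self hv.injOn (mem_univ _)]; ring
  · rw [Lagrange.eval_basis_of_ne (v := v) (fun h => hjk h.symm) (mem_univ _)]; ring

/-- `∑ v_k ℓ_k - X` vanishes at every node (Lagrange interpolation of `X`). -/
theorem eval_sum_C_mul_basis_sub_X (hv : Function.Injective v) (j : ι) :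
    eval (v j) (∑ k, C (v k) * Lagrange.basis univ v k - X) = 0 := by
  rw [eval_sub, eval_X, eval_finsetSum, Finset.sum_eq_single j]
  · rw [eval_mul, eval_C, Lagrange.eval_basis_self hv.injOn (mem_univ _), mul_one, sub_self]
  · intro k _ hkj
    rw [eval_mul, eval_C, Lagrange.eval_basis_of_ne (v := v) hkj (mem_univ _), mul_zero]
  · intro h; exact absurd (mem_univ j) h

/-- `∑ ℓ_k = 1` (nonempty index type). -/
theorem sum_basis_eq_one (hv : Function.Injective v) [Nonempty ι] : ∑ k, Lagrange.basis univ v k = 1 :=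
  Lagrange.sum_basis hv.injOn univ_nonempty

omit [DecidableEq ι] in
/-- A polynomial vanishing at all the (distinct) nodes is divisible by the nodal polynomial. -/
theorem nodal_dvd_of_eval_eq_zero (hv : Function.Injective v) (q : K[X]) (hq : ∀ j, eval (v j) q = 0) :
    (∏ k, (X - C (v k))) ∣ q :=
  Fintype.prod_dvd_of_coprime (pairwise_coprime_X_sub_C hv) fun k => dvd_iff_isRoot.mpr (hq k)

end Lagrange

/-! ## §3 Matrix consequences -/

/-- Polynomials in `E` commute. -/
theorem aeval_mul_comm (E : Matrix (Fin d) (Fin d) K) (p q : K[X]) :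
    aeval E p * aeval E q = aeval E q * aeval E p := by
  rw [← map_mul, ← map_mul, mul_comm]

/-- If `P ∣ q` then `q(E)` kills the kernel projection of `N = P(E)`. -/
theorem aeval_mul_kerProj_eq_zero (E B : Matrix (Fin d) (Fin d) K) (P q : K[X])
    (hB : aeval E P * B * aeval E P = aeval E P) (hq : P ∣ q) : aeval E q * (1 - B * aeval E P) = 0 := by
  obtain ⟨r, hr⟩ := hq
  rw [hr, mul_comm, map_mul]
  exact mul_kerProj_eq_zero _ B _ hB

/-- The nodal polynomial at the nodes `0, …, n`, written as the list product used by the Number Operator Lemma. -/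
theorem nodal_eq_listProd (n : ℕ) :
    (∏ k : Fin (n + 1), (X - C (((k : ℕ) : K)))) =
      ((List.range (n + 1)).map fun l => X - C ((n - l : ℕ) : K)).prod := by
  have h1 : ∀ (m : ℕ) (f : ℕ → K[X]), ((List.range m).map f).prod = ∏ l ∈ range m, f l := by
    intro m f
    induction m with
    | zero => simp
    | succ m ih => rw [List.range_succ, List.map_append, List.prod_append, ih, Finset.prod_range_succ]; simp
  rw [h1, ← Fin.prod_univ_eq_prod_range (fun l => X - C ((n - l : ℕ) : K)) (n + 1)]
  -- reflect `k ↦ n - k` on `Fin (n+1)`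
  refine Fintype.prod_equiv Fin.revPerm _ _ fun k => ?_
  simp only [Fin.revPerm_apply, Fin.val_rev]
  congr 3
  omega

/-- `aeval E` of the list product is the list product of the Number Operator Lemma. -/
theorem aeval_listProd (E : Matrix (Fin d) (Fin d) K) (n : ℕ) :
    aeval E (((List.range (n + 1)).map fun l => X - C ((n - l : ℕ) : K)).prod) =
      ((List.range (n + 1)).map fun l => E - ((n - l : ℕ) : K) • (1 : Matrix (Fin d) (Fin d) K)).prod := by
  rw [map_list_prod, List.map_map]
  congr 1
  refine List.map_congr_left fun l _ => ?_
  simp only [Function.comp_apply, map_sub, aeval_X, aeval_C, Algebra.algebraMap_eq_smul_one]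

/-! ## §4 The abstract construction and the registered stub -/

/-- Abstract core: from `N B N = N`, matrices `L_k` commuting with `N` whose pairwise products, idempotency
defects and weighted sum (minus `E`) are killed by the kernel projection `π = 1 - B N`, and `∑ L_k = 1`, build the
exact complete orthogonal family `Q_k = L_k π + [k = 0](1 - π)` with `∑ k•Q_k = E π`. -/
theorem core {n : ℕ} (E N B : Matrix (Fin d) (Fin d) K) (L : Fin (n + 1) → Matrix (Fin d) (Fin d) K)
    (hB : N * B * N = N) (hLN : ∀ k, L k * N = N * L k)
    (hLL : ∀ k l, k ≠ l → L k * L l * (1 - B * N) = 0)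
    (hL2 : ∀ k, (L k * L k - L k) * (1 - B * N) = 0) (hLsum : ∑ k, L k = 1)
    (hLE : (∑ k : Fin (n + 1), ((k : ℕ) : K) • L k - E) * (1 - B * N) = 0) :
    ∃ Q : Fin (n + 1) → Matrix (Fin d) (Fin d) K,
      (∀ k, Q k * Q k = Q k) ∧ (∀ k l, k ≠ l → Q k * Q l = 0) ∧ (∑ k, Q k = 1) ∧
      (∑ k : Fin (n + 1), ((k : ℕ) : K) • Q k) = E * (1 - B * N) := by
  have hprod : ∀ k l, (L k * (1 - B * N) + if k = 0 then 1 - (1 - B * N) else 0) *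
      (L l * (1 - B * N) + if l = 0 then 1 - (1 - B * N) else 0) =
      L k * L l * (1 - B * N) + if k = 0 ∧ l = 0 then 1 - (1 - B * N) else 0 := by
    intro k l
    have h0 : L k * (1 - B * N) * (L l * (1 - B * N)) = L k * L l * (1 - B * N) := by
      rw [Matrix.mul_assoc, kerProj_mul_mul_kerProj N B (L l) hB (hLN l), ← Matrix.mul_assoc]
    have h1 := mul_kerProj_mul_one_sub N B (L k) hB
    have h2 := one_sub_mul_mul_kerProj N B (L l) hB (hLN l)
    have h3 := one_sub_kerProj_idem N B hB
    simp only [add_mul, mul_add, ite_mul, mul_ite, zero_mul, mul_zero, h0, h1, h2, h3]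
    by_cases hk : k = 0 <;> by_cases hl : l = 0 <;> simp [hk, hl]
  refine ⟨fun k => L k * (1 - B * N) + if k = 0 then 1 - (1 - B * N) else 0, ?_, ?_, ?_, ?_⟩
  · intro k
    simp only [hprod, and_self]
    congr 1
    have h := hL2 k
    rwa [sub_mul, sub_eq_zero] at h
  · intro k l hkl
    simp only [hprod]
    rw [hLL k l hkl, if_neg (fun h => hkl (h.1.trans h.2.symm)), zero_add]
  · simp only [Finset.sum_add_distrib, Finset.sum_ite_eq', Finset.mem_univ, if_true]
    rw [← Finset.sum_mul, hLsum, one_mul, add_sub_cancel]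
  · simp only [smul_add, smul_ite, smul_zero, Finset.sum_add_distrib, Finset.sum_ite_eq', Finset.mem_univ,
      if_true, Fin.val_zero, Nat.cast_zero, zero_smul, add_zero]
    have h : ∑ k : Fin (n + 1), ((k : ℕ) : K) • (L k * (1 - B * N)) =
        (∑ k : Fin (n + 1), ((k : ℕ) : K) • L k) * (1 - B * N) := by
      rw [Finset.sum_mul]; simp only [smul_mul_assoc]
    rw [h]
    rwa [sub_mul, sub_eq_zero] at hLE

/-- Registered stub `stub_weightDecomposition` (crux `stmt-PneNP-18923`, line `rank-dehn-ladder`, rung N0c): the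
approximate weight decomposition of an almost-representation by an EXACT complete orthogonal family of `n + 1`
idempotents, at polynomial rank cost `10(n+1)⁴t`. -/
theorem stub_weightDecomposition :
    ∀ (K : Type) [Field K] [CharZero K] (n d t : ℕ) (ε : Fin n → Matrix (Fin d) (Fin d) K),
      (∀ i, ε i * ε i = ε i) → (∀ i j, (ε i * ε j - ε j * ε i).rank ≤ t) →
      ∃ Q : Fin (n + 1) → Matrix (Fin d) (Fin d) K,
        (∀ k, Q k * Q k = Q k) ∧ (∀ k l, k ≠ l → Q k * Q l = 0) ∧ (∑ k, Q k = 1) ∧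
        (∀ i k, (Q k * ε i - ε i * Q k).rank ≤ 10 * (n + 1) ^ 4 * t) ∧
        ((∑ k : Fin (n + 1), ((k : ℕ) : K) • Q k) - ∑ i, ε i).rank ≤ 10 * (n + 1) ^ 4 * t := by
  intro K _ _ n d t ε hε ht
  have hv : Function.Injective (fun k : Fin (n + 1) => ((k : ℕ) : K)) := fun a b h =>
    Fin.ext (Nat.cast_injective (R := K) h)
  -- the nodal matrix `N = ∏ (E - k)` and its rank (Number Operator Lemma)
  have hNrank : (aeval (∑ i, ε i) (∏ k : Fin (n + 1), (X - C (((k : ℕ) : K))))).rank ≤ n ^ 3 * t := by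
    rw [nodal_eq_listProd, aeval_listProd]; exact rank_numberOperator_le ε hε t ht
  obtain ⟨B, hB⟩ := exists_generalized_inverse (aeval (∑ i, ε i) (∏ k : Fin (n + 1), (X - C (((k : ℕ) : K)))))
  set E : Matrix (Fin d) (Fin d) K := ∑ i, ε i with hE
  set P : K[X] := ∏ k : Fin (n + 1), (X - C (((k : ℕ) : K))) with hP
  set N : Matrix (Fin d) (Fin d) K := aeval E P with hN
  have hvan : ∀ q : K[X], (∀ j : Fin (n + 1), eval ((fun k : Fin (n + 1) => ((k : ℕ) : K)) j) q = 0) →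
      aeval E q * (1 - B * N) = 0 :=
    fun q hq => aeval_mul_kerProj_eq_zero E B P q hB (nodal_dvd_of_eval_eq_zero hv q hq)
  -- the Lagrange matrices `L_k = ℓ_k(E)`
  have hLN : ∀ k : Fin (n + 1),
      aeval E (Lagrange.basis univ (fun k : Fin (n + 1) => ((k : ℕ) : K)) k) * N =
        N * aeval E (Lagrange.basis univ (fun k : Fin (n + 1) => ((k : ℕ) : K)) k) :=
    fun k => aeval_mul_comm E _ _
  have hLL : ∀ k l : Fin (n + 1), k ≠ l →
      aeval E (Lagrange.basis univ (fun k : Fin (n + 1) => ((k : ℕ) : K)) k) *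
        aeval E (Lagrange.basis univ (fun k : Fin (n + 1) => ((k : ℕ) : K)) l) * (1 - B * N) = 0 := by
    intro k l hkl
    have h := hvan _ (eval_basis_mul_basis_of_ne hkl)
    rwa [map_mul] at h
  have hL2 : ∀ k : Fin (n + 1),
      (aeval E (Lagrange.basis univ (fun k : Fin (n + 1) => ((k : ℕ) : K)) k) *
        aeval E (Lagrange.basis univ (fun k : Fin (n + 1) => ((k : ℕ) : K)) k) -
        aeval E (Lagrange.basis univ (fun k : Fin (n + 1) => ((k : ℕ) : K)) k)) * (1 - B * N) = 0 := by
    intro k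
    have h := hvan _ (eval_basis_sq_sub_basis hv k)
    rwa [map_sub, map_mul] at h
  have hLsum : ∑ k, aeval E (Lagrange.basis univ (fun k : Fin (n + 1) => ((k : ℕ) : K)) k) = 1 := by
    rw [← map_sum, sum_basis_eq_one hv, map_one]
  have hLE : (∑ k : Fin (n + 1), ((k : ℕ) : K) •
      aeval E (Lagrange.basis univ (fun k : Fin (n + 1) => ((k : ℕ) : K)) k) - E) * (1 - B * N) = 0 := by
    have h := hvan _ (eval_sum_C_mul_basis_sub_X hv)
    simpa only [map_sub, aeval_X, map_sum, map_mul, aeval_C, Algebra.algebraMap_eq_smul_one, smul_one_mul]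
      using h
  obtain ⟨Q, hidem, horth, hsum, hD⟩ := core E N B _ hB hLN hLL hL2 hLsum hLE
  -- rank bookkeeping
  have hDE0 : (E * (1 - B * N) - E).rank ≤ n ^ 3 * t := by
    have h : E * (1 - B * N) - E = -(E * (B * N)) := by rw [mul_sub, mul_one]; abel
    rw [h, rk_neg]
    exact (Matrix.rank_mul_le_right _ _).trans ((Matrix.rank_mul_le_right _ _).trans hNrank)
  have hnum1 : n ^ 3 * t ≤ 10 * (n + 1) ^ 4 * t := by
    have h1 : n ^ 3 ≤ (n + 1) ^ 3 := Nat.pow_le_pow_left (Nat.le_succ n) 3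
    have h2 : (n + 1) ^ 3 ≤ (n + 1) ^ 4 := Nat.pow_le_pow_right (Nat.succ_pos n) (by norm_num)
    exact Nat.mul_le_mul_right t (by omega)
  have hnum2 : 2 * ((n + 1) * (2 * (n ^ 3 * t) + n * t)) ≤ 10 * (n + 1) ^ 4 * t := by
    have h1 : n ^ 3 ≤ (n + 1) ^ 3 := Nat.pow_le_pow_left (Nat.le_succ n) 3
    have h2 : n ≤ (n + 1) ^ 3 := (Nat.le_succ n).trans (Nat.le_self_pow (by norm_num) _)
    have h3 : 4 * n ^ 3 + 2 * n ≤ 10 * (n + 1) ^ 3 := by linarith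
    calc 2 * ((n + 1) * (2 * (n ^ 3 * t) + n * t)) = (n + 1) * ((4 * n ^ 3 + 2 * n) * t) := by ring
      _ ≤ (n + 1) * ((10 * (n + 1) ^ 3) * t) := Nat.mul_le_mul_left _ (Nat.mul_le_mul_right _ h3)
      _ = 10 * (n + 1) ^ 4 * t := by ring
  refine ⟨Q, hidem, horth, hsum, fun i k => ?_, ?_⟩
  · -- commutator estimate via Cauchy compression
    have hDcomm : ((E * (1 - B * N)) * ε i - ε i * (E * (1 - B * N))).rank ≤ 2 * (n ^ 3 * t) + n * t := by
      have e2 : (E * (1 - B * N)) * ε i - ε i * (E * (1 - B * N)) =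
          ((E * (1 - B * N) - E) * ε i - ε i * (E * (1 - B * N) - E)) + (E * ε i - ε i * E) := by
        simp only [sub_mul, mul_sub]; abel
      rw [e2]
      refine (rk_add _ _).trans (Nat.add_le_add ?_ ?_)
      · refine (rk_sub _ _).trans ?_
        have a1 := (Matrix.rank_mul_le_left (E * (1 - B * N) - E) (ε i)).trans hDE0
        have a2 := (Matrix.rank_mul_le_right (ε i) (E * (1 - B * N) - E)).trans hDE0
        omega
      · have e3 : E * ε i - ε i * E = ∑ j, (ε j * ε i - ε i * ε j) := by
          rw [hE, Finset.sum_mul, Finset.mul_sum, ← Finset.sum_sub_distrib]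
        rw [e3]
        refine (rank_sum_le _ _).trans ?_
        calc ∑ j, (ε j * ε i - ε i * ε j).rank ≤ ∑ _j : Fin n, t := Finset.sum_le_sum fun j _ => ht j i
          _ = n * t := by simp
    have hc1 := compression_commutes Q hidem horth (ε i) k
    have e1 : Q k * ε i - ε i * Q k =
        Q k * (ε i - ∑ a, Q a * ε i * Q a) - (ε i - ∑ a, Q a * ε i * Q a) * Q k := by
      rw [mul_sub, sub_mul, hc1]; abel
    have hY : (ε i - ∑ a, Q a * ε i * Q a).rank ≤
        (n + 1) * ((∑ a : Fin (n + 1), ((a : ℕ) : K) • Q a) * ε i -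
          ε i * ∑ a : Fin (n + 1), ((a : ℕ) : K) • Q a).rank :=
      rank_sub_compression_le Q hidem horth hsum (fun k : Fin (n + 1) => ((k : ℕ) : K)) hv (ε i)
    rw [hD] at hY
    have hY' := hY.trans (Nat.mul_le_mul_left (n + 1) hDcomm)
    rw [e1]
    refine (rk_sub _ _).trans ?_
    have a1 := Matrix.rank_mul_le_right (Q k) (ε i - ∑ a, Q a * ε i * Q a)
    have a2 := Matrix.rank_mul_le_left (ε i - ∑ a, Q a * ε i * Q a) (Q k)
    calc _ ≤ 2 * ((n + 1) * (2 * (n ^ 3 * t) + n * t)) := by omega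
      _ ≤ 10 * (n + 1) ^ 4 * t := hnum2
  · rw [hD]; exact hDE0.trans hnum1

end Summit.PneNP.PneNP.Theorems.CnfIdealGenLengthRankDefectRepresentationsWeightDecomposition
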